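import Summits.QuantumFields.BalabanUV.T4Continuum.Support.NE3ProductPathChart
import Summits.QuantumFields.BalabanUV.T4Continuum.Support.NE3EndpointChartFlat
import Summits.QuantumFields.BalabanUV.T4Continuum.Support.NE3CurvedFrameKill
import Summits.QuantumFields.BalabanUV.T4Continuum.Support.AveragingDeficitMultiLevelBridge
import HarnessLib

/-!
# T⁴ programme, node NE3 — NON-VACUITY OF THE DECOMPOSITION SHAPE `DecomposedRep` AT THE FLAT DATUM
# (and the owner's `endpointChart_of_decomposedRep` exercised there)

NE3 formalisation swarm `b2b-balaban-t4-ne3-formalise-*`, LEAF PROVER 04 (gen 6); A-NV-style node, sequel of `NE3EndpointChartFlat`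
(p238189), announced in XREAD X5 (GAPS § C-ne3leaf04g6-5, INFO (iii)).  In the flat class `MinimalActionWitness.flatClass` with the flat
datum and the flat pair, the trivial data — gauge `u = 1`, tangent datum `X = 0`, normal part `N = 0`, sup letters `α = αN = 0`, ANY sizes
`ν, κ₁, κ₂`, any radius `a ≥ 0` — satisfy every one of the 22 fields of the owner's `NE3ProductPathChart.DecomposedRep` (p237527).  The only
field with content is the SLICE CONDITION `0 ∈ T_♮(1) = frameFreeBlockLandauW L N k flatCfg`, i.e. `TangentIter L (k−1) 1 0` and
`framePotW L k 1 0 = 0`, obtained from this lineage's additivity theorems `NE3TangentCovariantTower.dirIter_add` ∕ `NE3CurvedFrameKill.framePotW_add`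
in the (non-empty: `AveragingDeficitMultiLevelBridge.exists_levelSmall`) multi-level small-field class of the flat configuration.

CONTENT (all [folklore]; 0 sorry; 0 def): `dirIter_flatCfg_zero`, `tangentIter_flatCfg_zero`, `framePotW_flatCfg_zero`,
**`zero_mem_frameFreeBlockLandauW_flatCfg`**, `pathΓ_zero_zero`, **`decomposedRep_flat`**, **`endpointChart_of_decomposedRep_flat`**.

HONEST FRAMING.  Non-vacuity at the FLAT datum only (every inequality reads `0 ≤ 0` or `c·0 ≤ c·0`); `DecomposedRep` remains a HYPOTHESIS
for Bałaban's minimisers (suppliers Π-R ∕ Π-C ∕ Π-L1♮ in flight); (P♮)_W's uniformity, T-E_w♯ and NE3 are NOT proved; spine PROVED 0∕9; finite T⁴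
rung (B)+1 — NOT infinite volume, NOT mass gap, NOT BetaPertH, NOT Clay.  ABSOLUTE RULE kept.  PLACEMENT: `Summits/QuantumFields/BalabanUV/`.
HONEST DEPENDENCY: continuum YM on T⁴ ⇐ BetaPertH ∧ nine spine estimates (0/9 proved); BetaPertH ⇐ (D1) ∧ (D4) ∧ CAP+tail; G-an2-4 gates asym, D1 and NE2/3/4.
-/

set_option autoImplicit false

open scoped BigOperators Matrix.Norms.L2Operator
open NormedSpace Finset

namespace Summit.QuantumFields.BalabanUV.T4Continuum.NE3DecomposedRepFlat

open Set
open Literature.MathematicalPhysics.QuantumFieldTheory.Balaban1983to89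
open B7Prop1Explicit B7Prop2Explicit MatrixLog
open T4AveragingDeficitWall (IsSkewDir IsUnitaryCfg SmallField vary curl fhol dirL1 flat_mem_classes)
open T4AveragingDeficitWallBoundary (periodBox)
open AveragingDeficitPeriodicCounting (IsPeriodicDir)
open AveragingDeficitChartCalculus (cavg)
open AveragingDeficitMultiLevelPrep (TangentIter tower LevelSmall)
open AveragingDeficitMultiLevelBridge (exists_levelSmall)
open MinimalActionLevels (perWin)
open MinimalActionSandwich (admissible)
open MinimalActionWitness (flatCfg flatClass flatCfg_mem_admissible fhol_flatCfg)
open NE3EnergyShapes (IsUnitarySite IsPeriodicSite gaugeAct_one)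
open NE3EnergyWeightedShapes (energyNormW energyNormW_zero)
open NE3CovariantCalculus (hsR)
open NE3LandauOrbit (hsR_zero_left)
open NE3TangentCovariantTower (dirIter framePotW dirIter_add tangentIter_iff_dirIter_eq_zero)
open NE3CurvedFrameKill (framePotW_add)
open NE3FrameFreeSliceW (frameFreeBlockLandauW)
open NE3EndpointChart (EndpointChart)
open NE3EndpointChartFlat (cavg_flatCfg)
open NE3ProductPath (pathΓ prodM expN expX vel acc)
open NE3ProductPathChart (DecomposedRep endpointChart_of_decomposedRep)

noncomputable section

variable {d : ℕ} {n : Type*} [Fintype n] [DecidableEq n]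

/-! ## §1 The zero direction lies in the curved frame-free slice of the flat background -/

/-- The flat configuration is unitary and lies in every small-field class (tree `flat_mem_classes`, re-read for `flatCfg`). [folklore] -/
theorem flatCfg_classes {a : ℝ} (ha : 0 ≤ a) :
    IsUnitaryCfg (flatCfg (d := d) (n := n)) ∧ SmallField (flatCfg (d := d) (n := n)) a :=
  flat_mem_classes ha

/-- The `(j+1)`-fold linearised average of the zero direction at the flat background vanishes. [folklore] -/
theorem dirIter_flatCfg_zero [Nonempty n] {L : ℕ} [NeZero L] (hL : 1 ≤ L) (j : ℕ) :
    dirIter L (j + 1) (flatCfg (d := d) (n := n)) (fun _ _ => 0) = 0 := by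
  obtain ⟨b, hb0, hb⟩ := exists_levelSmall (d := d) L j
  obtain ⟨hu, hs⟩ := flatCfg_classes (d := d) (n := n) hb0.le
  have h := dirIter_add hL j (W := flatCfg) (x := b) hu hb0.le hb hs (fun _ _ => 0) (fun _ _ => 0)
  simp only [add_zero] at h
  funext z κ
  have hz := congr_fun (congr_fun h z) κ
  simpa using hz

/-- Hence the zero direction is tangent to every fibre of the tower at the flat background. [folklore] -/
theorem tangentIter_flatCfg_zero [Nonempty n] {L : ℕ} [NeZero L] (hL : 1 ≤ L) (j : ℕ) :
    TangentIter L j (flatCfg (d := d) (n := n)) (fun _ _ => 0) :=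
  (tangentIter_iff_dirIter_eq_zero L j _ _).mpr (dirIter_flatCfg_zero hL j)

/-- The accumulated frames of the zero direction vanish at the flat background. [folklore] -/
theorem framePotW_flatCfg_zero [Nonempty n] {L : ℕ} [NeZero L] (hL : 1 ≤ L) :
    ∀ (k : ℕ) (z : Site d), framePotW L k (flatCfg (d := d) (n := n)) (fun _ _ => 0) z = 0
  | 0, _ => rfl
  | j + 1, z => by
      obtain ⟨b, hb0, hb⟩ := exists_levelSmall (d := d) L j
      obtain ⟨hu, hs⟩ := flatCfg_classes (d := d) (n := n) hb0.le
      have h := framePotW_add hL j (W := flatCfg) (x := b) hu hb0.le hb hs (fun _ _ => 0) (fun _ _ => 0) z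
      simp only [add_zero] at h
      simpa using h

/-- **THE ZERO DIRECTION LIES IN THE SLICE `T_♮(1)`**: `0 ∈ frameFreeBlockLandauW L N k flatCfg`. [folklore] -/
theorem zero_mem_frameFreeBlockLandauW_flatCfg [Nonempty n] {L : ℕ} [NeZero L] (hL : 1 ≤ L) (N k : ℕ) :
    (fun (_ : Site d) (_ : Fin d) => (0 : Matrix n n ℂ)) ∈ frameFreeBlockLandauW (d := d) (n := n) L N k flatCfg := by
  refine ⟨fun _ _ => (skewAdjoint _).zero_mem, fun _ _ _ => rfl, tangentIter_flatCfg_zero hL (k - 1),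
    fun z => framePotW_flatCfg_zero hL k z, fun μ _ => ?_⟩
  simp [hsR_zero_left]

/-! ## §2 The decomposition shape at the flat datum -/

/-- The product path of the zero data is the constant path `0`. [folklore] -/
theorem pathΓ_zero_zero (t : ℝ) :
    pathΓ (fun (_ : Site d) (_ : Fin d) => (0 : Matrix n n ℂ)) (fun _ _ => 0) t = fun (_ : Site d) (_ : Fin d) => (0 : Matrix n n ℂ) := by
  funext x μ
  simp [pathΓ, prodM, expN, expX]

/-- **NON-VACUITY OF `DecomposedRep` AT THE FLAT DATUM**: flat class, flat datum and pair, `u = 1`, `X = N = 0`, `α = αN = 0`, ANY sizes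
`ν κ₁ κ₂`, any radius `a ≥ 0` (`L ≥ 1`). [folklore] -/
theorem decomposedRep_flat [Nonempty n] {L : ℕ} [NeZero L] (hL : 1 ≤ L) (N k : ℕ) (ν κ₁ κ₂ : ℝ) {a : ℝ} (ha : 0 ≤ a) :
    DecomposedRep (flatClass (d := d) (n := n)) L N k flatCfg flatCfg flatCfg (fun _ => 1)
      (fun _ _ => 0) (fun _ _ => 0) 0 0 ν κ₁ κ₂ a where
  gauge := ⟨fun _ => (unitaryUnits (Matrix n n ℂ)).one_mem, fun _ _ => rfl⟩
  rep := by
    intro x μ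
    rw [gaugeAct_one, cavg_flatCfg]
    simp [MinimalActionWitness.flatCfg]
  skewX := fun _ _ => (skewAdjoint _).zero_mem
  perX := fun _ _ _ => rfl
  skewN := fun _ _ => (skewAdjoint _).zero_mem
  perN := fun _ _ _ => rfl
  tangent := by rw [cavg_flatCfg]; exact zero_mem_frameFreeBlockLandauW_flatCfg hL N k
  supX := fun _ _ => by simp
  supN := fun _ _ => by simp
  hα0 := le_rfl
  hαN0 := le_rfl
  hα := by norm_num
  hαN := by norm_num
  hαk := by norm_num
  admW := by rw [cavg_flatCfg]; exact flatCfg_mem_admissible L k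
  ha := ha
  small := by
    intro t _ p _
    rw [cavg_flatCfg, pathΓ_zero_zero, T4AveragingDeficitWall.vary_zero_dir, fhol_flatCfg, Units.val_one, sub_self, norm_zero]
    exact ha
  nwN := by rw [energyNormW_zero]; simp
  curlN := by
    rw [energyNormW_zero]
    simp [T4AveragingDeficitWall.curl_zero_dir]
  l1N := by rw [energyNormW_zero]; simp

/-- **THE OWNER'S DERIVATION EXERCISED AT THE FLAT DATUM**: `endpointChart_of_decomposedRep` applied to `decomposedRep_flat` (`L, N ≥ 1`). [folklore] -/
theorem endpointChart_of_decomposedRep_flat [Nonempty n] {L : ℕ} [NeZero L] (hL : 1 ≤ L) {N : ℕ} (hN : 1 ≤ N) (k : ℕ)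
    (ν κ₁ κ₂ : ℝ) {a : ℝ} (ha : 0 ≤ a) :
    EndpointChart (flatClass (d := d) (n := n)) L N k flatCfg flatCfg flatCfg (fun _ => 1)
      (pathΓ (fun _ _ => 0) (fun _ _ => 0))
      (fun t x μ => vel ((fun (_ : Site d) (_ : Fin d) => (0 : Matrix n n ℂ)) x μ) ((fun (_ : Site d) (_ : Fin d) => (0 : Matrix n n ℂ)) x μ) t)
      (fun t x μ => acc ((fun (_ : Site d) (_ : Fin d) => (0 : Matrix n n ℂ)) x μ) ((fun (_ : Site d) (_ : Fin d) => (0 : Matrix n n ℂ)) x μ) t)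
      (fun _ _ => 0) (frameFreeBlockLandauW L N k (cavg L flatCfg))
      (fun Y => energyNormW L k (cavg L flatCfg) Y (periodBox (N * L ^ k)))
      (2 * (1 + 4 * Real.sqrt (16 * d + 1)) * ν) (2 * κ₁ + 912 * d * κ₂)
      (ν + 23 * Real.sqrt 2 * Real.sqrt (16 * d + 1) * (1 + ν)) 0 a := by
  have hW : IsUnitaryCfg (cavg L (flatCfg (d := d) (n := n))) := by
    rw [cavg_flatCfg]; exact (flatCfg_classes (d := d) (n := n) le_rfl).1
  exact endpointChart_of_decomposedRep hL hN hW (decomposedRep_flat hL N k ν κ₁ κ₂ ha)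

end

end Summit.QuantumFields.BalabanUV.T4Continuum.NE3DecomposedRepFlat
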